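import Mathlib
import Summits.Ventures.PercRepro2.Defs
import Summits.Ventures.PercRepro2.Independence
import Summits.Ventures.PercRepro2.Harris
import Summits.Ventures.PercRepro2.Graph
import Summits.Ventures.PercRepro2.Events
import Summits.Ventures.PercRepro2.ZCTwoEdge
import Summits.Ventures.PercRepro2.ZCTwoEdgeGraph
import Summits.Ventures.PercRepro2.ZCLeafReductions
import Summits.Ventures.PercRepro2.ZCLeafReductionsGraph

/-!
# The closure in action: (ZC) when `a₁` sees only `a₃` and `z`, and `o` is a leaf at `z`
(blind cell PercRepro2, mine-a g23; MINE-A.md §70.4, the example)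

A graph outside every class proved before this seat: the root `a₁` is joined to the rest only by
`f₁ = a₁a₃` and `f₂ = a₁z`, and the mark `o` is a leaf at `z` (edge `f = zo`).  The `o`-leaf
reduction `zc_leaf_o_graph` gives `(ZC)_p(a₁, a₃, o; 𝓔) ≥ p f · (ZC)_{p[f↦0]}(a₁, a₃, z; 𝓔_z)`, and
the right-hand side is Theorem A (`zc_two_edge_graph`) for the marks `(a₁, a₃, z)` and the up-set
`𝓔_z` on the same graph under `p[f ↦ 0]`: nonnegative.  One seat.
-/

namespace Summit.Ventures.PercRepro2

section ClosureExample

variable {V : Type*} {E : Type*} [Fintype E] [DecidableEq E] {R : Type*} [CommRing R]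
  [LinearOrder R] [IsStrictOrderedRing R]

/-- **(ZC) for «`a₁` of degree two towards `a₃`, `z`; `o` a leaf at `z`»**, every weight vector,
every up-set `𝓔` with `{a₁} ∉ 𝓔`: the composition of `zc_leaf_o_graph` and `zc_two_edge_graph`. -/
theorem zc_two_edge_leaf_example {p : E → R} (hp : IsProbVec p) {ends : E → Sym2 V}
    {a₁ a₃ o z : V} {f₁ f₂ f : E} (hf : f₁ ≠ f₂) (hends₁ : ends f₁ = s(a₁, a₃))
    (hends₂ : ends f₂ = s(a₁, z)) (hroot : ∀ e, a₁ ∈ ends e → e = f₁ ∨ e = f₂) (h13 : a₁ ≠ a₃)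
    (h1z : a₁ ≠ z) (hends : ends f = s(z, o)) (hleaf : ∀ e, o ∈ ends e → e = f) (ho1 : o ≠ a₁)
    (ho3 : o ≠ a₃) (hoz : o ≠ z) {𝓔 : Set (Set V)} (h𝓔 : IsUpperSet 𝓔)
    (h𝓔₁ : ({a₁} : Set V) ∉ 𝓔) :
    let e := connEvent ends a₁ a₃
    let L := connEvent ends a₁ o
    let U := clusterInEvent ends a₁ 𝓔
    let γ := connEvent ends a₃ o
    0 ≤ prob p (eᶜ ∩ Lᶜ ∩ γᶜ) * (prob p (U ∩ (e ∩ L)) - prob p U * prob p (e ∩ L))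
      - prob p (eᶜ ∩ Lᶜ ∩ γ) * (prob p (U ∩ (e ∩ Lᶜ)) - prob p U * prob p (e ∩ Lᶜ)) := by
  intro e L U γ
  -- the leaf reduction
  have hred := zc_leaf_o_graph hp hends hleaf ho1 ho3 hoz h𝓔
  simp only at hred
  refine le_trans ?_ hred
  -- Theorem A on `G − o` for the marks `(a₁, a₃, z)` and the up-set `𝓔_z`
  set p' := Function.update p f 0 with hp'def
  have hp' : IsProbVec p' := hp.update f le_rfl zero_le_one
  set 𝓔z : Set (Set V) := {S | (z ∈ S ∧ insert o S ∈ 𝓔) ∨ (z ∉ S ∧ S ∈ 𝓔)} with h𝓔zdef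
  have h𝓔zup : IsUpperSet 𝓔z := by
    intro S S' hSS' hS
    rcases hS with ⟨hzS, hS⟩ | ⟨hzS, hS⟩
    · exact Or.inl ⟨hSS' hzS, h𝓔 (Set.insert_subset_insert hSS') hS⟩
    · by_cases hz' : z ∈ S'
      · exact Or.inl ⟨hz', h𝓔 ((hSS'.trans (Set.subset_insert _ _))) hS⟩
      · exact Or.inr ⟨hz', h𝓔 hSS' hS⟩
  have h𝓔z₁ : ({a₁} : Set V) ∉ 𝓔z := by
    rintro (⟨hz, _⟩ | ⟨_, h⟩)
    · exact h1z (Set.mem_singleton_iff.1 hz).symm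
    · exact h𝓔₁ h
  have hA := zc_two_edge_graph hp' hf hends₁ hends₂ hroot h13 h1z h𝓔zup h𝓔z₁
  simp only at hA
  -- the bound of Theorem A is nonnegative
  have hbound : 0 ≤ (1 - p' f₁) ^ 2 * (1 - p' f₂) ^ 2 * p' f₂
      * (prob p' {ω | Conn ends (Function.update (Function.update ω f₁ false) f₂ false) a₃ z}
          + p' f₁
          - prob p' {ω | Conn ends (Function.update (Function.update ω f₁ false) f₂ false) a₃ z}
            * p' f₁)
      * prob p' ({ω | {a₁} ∪ cluster ends (Function.update (Function.update ω f₁ false) f₂ false) a₃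
          ∪ cluster ends (Function.update (Function.update ω f₁ false) f₂ false) z ∈ 𝓔z}
          ∩ {ω | Conn ends (Function.update (Function.update ω f₁ false) f₂ false) a₃ z}ᶜ) := by
    have hg0 : 0 ≤ prob p' {ω | Conn ends (Function.update (Function.update ω f₁ false) f₂ false) a₃ z} :=
      prob_nonneg hp' _
    have hπ : 0 ≤ prob p' {ω | Conn ends (Function.update (Function.update ω f₁ false) f₂ false) a₃ z}
        + p' f₁
        - prob p' {ω | Conn ends (Function.update (Function.update ω f₁ false) f₂ false) a₃ z}
          * p' f₁ := by
      have := mul_nonneg hg0 (sub_nonneg.2 (hp'.le_one f₁))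
      have := hp'.nonneg f₁
      nlinarith
    exact mul_nonneg (mul_nonneg (mul_nonneg (mul_nonneg (sq_nonneg _) (sq_nonneg _))
      (hp'.nonneg f₂)) hπ) (prob_nonneg hp' _)
  exact mul_nonneg (hp.nonneg f) (le_trans hbound hA)

end ClosureExample

end Summit.Ventures.PercRepro2
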